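import Literature.Analysis.FluidPDE.StokesTorus
import Literature.Analysis.FluidPDE.LerayProjectorTorusProofs
import HarnessLib

/-!
# Positivity of the Stokes operator on the flat torus (proofs)

`Literature.Analysis.FluidPDE.StokesTorus` vendors, as the named facts
`Torus.isPositive_stokesOperatorH` and `Torus.isPositive_stokesOperator`, the positivity of the
Stokes operator `A = -P Δ = -Δ` on the flat torus `T^d`, in the Hilbert space
`H = Torus.energySpace d` (`Torus.stokesOperatorH d`) and as an `L²(T^d; ℝ^d)`-valued partially
defined operator (`Torus.stokesOperator d`): `A` is symmetric and `0 ≤ ⟪v, A v⟫` on `D(A)`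
(H21 `LinearPMap.IsPositive`; Constantin–Foias 1988, Ch. 4, Prop. 4.2 with (4.4)
`(Au, v) = ((u, v))`, and the periodic case (4.35)–(4.37): `(Au)_k = 4π²|k|² u_k / L²`). This file
**proves** both: `Torus.isPositive_stokesOperatorH_holds`, `Torus.isPositive_stokesOperator_holds`.
(It is a sibling of `StokesTorusProofs`, kept separate because it needs the Fourier-side
description of `H` from `LerayProjectorTorusProofs`, which `StokesTorusProofs` does not import.)

## Proof

The operator is built from its graph: `(v, w) ∈ Torus.stokesGraph d` iff `v, w ∈ H` and
`⟪w, g⟫ = -⟪v, Δ g⟫` for every smooth divergence-free mean-zero field `g`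
(`Torus.IsStokesImage`). We follow Constantin–Foias' Fourier description of the periodic Stokes
operator (Ch. 4, (4.33)–(4.37)), reading everything off the Fourier coefficients
`v̂(k) = 𝓕(complexify ∘ v)(k) ∈ ℂ^d`:

* testing the graph relation against the single transversal real modes `Re (e_k • z)`
  (`k ≠ 0`, `k · z = 0`; smooth, divergence free, mean zero, with `Δ Re (e_k • z) =
  -4π²|k|² Re (e_k • z)`, `Torus.laplacian_realTrigPoly_singleton`) gives
  `⟪ŵ(k), z⟫_ℂ = 4π²|k|² ⟪v̂(k), z⟫_ℂ` for all transversal `z`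
  (`Torus.inner_toLp_realTrigPoly_singleton` for the pairing, `z` and `i z` for real and
  imaginary parts); since `v̂(k)` and `ŵ(k)` are themselves transversal and the zero modes vanish
  (`v, w ∈ H`: `Torus.isWeaklyDivFree_of_mem_energySpace`,
  `Torus.IsWeaklyDivFree.sum_mul_mFourierCoeff_eq_zero`,
  `Torus.mFourierCoeff_complexify_coe_zero_of_mem`), this is (4.37):
  `ŵ(k) = 4π²|k|² v̂(k)` for every `k` (`Torus.IsStokesImage.mFourierCoeff_eq`);
* Parseval for real vector fields (`Torus.hasSum_re_inner_mFourierCoeff_complexify`,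
  Grafakos 2014, Prop. 3.2.7) then gives `⟪w, v'⟫ = ∑_k 4π²|k|² Re ⟪v̂(k), v̂'(k)⟫ = ⟪v, w'⟫` for two
  graph pairs (symmetry, CF (4.4)) and `⟪v, w⟫ = ∑_k 4π²|k|² ‖v̂(k)‖² ≥ 0` (positivity).

The graph operators `Torus.stokesOperator d` / `Torus.stokesOperatorH d` are then positive by
`Submodule.mem_graph_toLinearPMap` (their graphs are functional,
`Torus.stokesGraph_fst_eq_zero_imp` / `Torus.stokesGraphH_fst_eq_zero_imp`), the inner product of
`H` being the restriction of that of `L²` (`Submodule.coe_inner`).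

## References

* P. Constantin, C. Foias, *Navier–Stokes Equations*, Univ. Chicago Press (1988), Ch. 4:
  Def. 4.1, Prop. 4.2 with (4.2)–(4.4) (symmetry, `(Au,v) = ((u,v))`), and the periodic case
  (4.33)–(4.37), (4.42). [ConstantinFoias1988]
* L. Grafakos, *Classical Fourier Analysis*, 3rd ed., GTM 249 (2014), Prop. 3.2.7 (3)
  (Parseval on `T^n`). [Grafakos2014]
-/

noncomputable section

open MeasureTheory Filter UnitAddTorus
open scoped InnerProductSpace RealInnerProductSpace ENNReal

namespace Literature.Analysis.FluidPDE

namespace Torus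

variable {d : Type*} [Fintype d] [DecidableEq d]

/-! ## Single transversal real modes are admissible test fields -/

omit [DecidableEq d] in
/-- A single real Fourier mode `Re (e_k • z)` with `k ≠ 0` has zero mean on `T^d`
(`∫ e_k = 0`, `Torus.integral_mFourier`). (Twin of the private lemma of
`LerayProjectorTorusProofs`.) [folklore] -/
theorem hasZeroMean_realTrigPoly_singleton_of_ne_zero {k : d → ℤ} (hk : k ≠ 0)
    (c : (d → ℤ) → EuclideanSpace ℂ d) :
    FunctionSpaces.Torus.HasZeroMean (FunctionSpaces.Torus.realTrigPoly {k} c) := by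
  unfold FunctionSpaces.Torus.HasZeroMean
  have h1 : (fun x => FunctionSpaces.Torus.realTrigPoly {k} c x) =
      fun x => FunctionSpaces.EuclideanSpace.realPart (mFourier k x • c k) :=
    funext fun x => FunctionSpaces.Torus.realTrigPoly_singleton_apply k c x
  have hint : Integrable (fun x : UnitAddTorus d => mFourier k x • c k) volume :=
    ((mFourier k).continuous.smul continuous_const).integrable_unitAddTorus
  rw [h1, ContinuousLinearMap.integral_comp_comm _ hint, integral_smul_const,
    FunctionSpaces.Torus.integral_mFourier, if_neg hk, zero_smul, map_zero]

/-! ## The graph relation on the Fourier side: `ŵ(k) = 4π²|k|² v̂(k)` -/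

/-- **Testing the weak Stokes relation against a transversal mode, real part.** If `w = -Δ v`
weakly (`Torus.IsStokesImage v w`), `k ≠ 0` and `z ∈ ℂ^d` is transversal (`k · z = 0`), then
`Re ⟪ŵ(k), z⟫_ℂ = 4π²|k|² Re ⟪v̂(k), z⟫_ℂ`: the test field `g = Re (e_k • z)` is smooth, divergence
free and mean zero with `Δ g = -4π²|k|² g`, and `⟪u, g⟫_{L²} = Re ⟪û(k), z⟫_ℂ`
(Constantin–Foias 1988, Ch. 4, (4.36)–(4.37)). [cite: ConstantinFoias1988, Ch. 4 (4.37)] -/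
theorem IsStokesImage.re_inner_mFourierCoeff
    {v w : Lp (EuclideanSpace ℝ d) 2 (volume : Measure (UnitAddTorus d))}
    (h : IsStokesImage v w) {k : d → ℤ} (hk : k ≠ 0) {z : EuclideanSpace ℂ d}
    (hz : ∑ j, (k j : ℂ) * z j = 0) :
    (inner ℂ (mFourierCoeff (FunctionSpaces.EuclideanSpace.complexify ∘
        (w : UnitAddTorus d → EuclideanSpace ℝ d)) k) z).re =
      stokesEigenvalue k * (inner ℂ (mFourierCoeff (FunctionSpaces.EuclideanSpace.complexify ∘
        (v : UnitAddTorus d → EuclideanSpace ℝ d)) k) z).re := by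
  -- the test field and its `L²` class
  set g : UnitAddTorus d → EuclideanSpace ℝ d :=
    FunctionSpaces.Torus.realTrigPoly {k} (fun _ => z) with hg_def
  have hgmem : MemLp g 2 (volume : Measure (UnitAddTorus d)) :=
    FunctionSpaces.Torus.memLp_realTrigPoly {k} (fun _ => z) 2
  set φ : Lp (EuclideanSpace ℝ d) 2 (volume : Measure (UnitAddTorus d)) := hgmem.toLp g
    with hφ_def
  have hφ : ((φ : Lp (EuclideanSpace ℝ d) 2 (volume : Measure (UnitAddTorus d))) :
      UnitAddTorus d → EuclideanSpace ℝ d) =ᵐ[volume] g := hgmem.coeFn_toLp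
  -- `Δ g = -λ g`, so the class of `Δ g` is `-λ • φ`
  have hψ : (((-stokesEigenvalue k) • φ :
      Lp (EuclideanSpace ℝ d) 2 (volume : Measure (UnitAddTorus d))) :
        UnitAddTorus d → EuclideanSpace ℝ d) =ᵐ[volume]
      fun x => FunctionSpaces.Torus.laplacian g x := by
    filter_upwards [Lp.coeFn_smul (-stokesEigenvalue k) φ, hφ] with x h1 h2
    rw [h1, Pi.smul_apply, h2, hg_def, FunctionSpaces.Torus.laplacian_realTrigPoly_singleton]
    rfl
  have hsmooth : FunctionSpaces.Torus.IsSmooth g :=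
    FunctionSpaces.Torus.isSmooth_realTrigPoly _ _
  have hdiv : FunctionSpaces.Torus.IsDivFree g :=
    FunctionSpaces.Torus.isDivFree_realTrigPoly_singleton (c := fun _ => z) hz
  have hmean : FunctionSpaces.Torus.HasZeroMean g :=
    hasZeroMean_realTrigPoly_singleton_of_ne_zero hk _
  -- the weak relation tested against `g`: `⟪w, φ⟫ = λ ⟪v, φ⟫`
  have hrel := h φ ((-stokesEigenvalue k) • φ) g hsmooth hdiv hmean hφ hψ
  rw [real_inner_smul_right, neg_mul, neg_neg] at hrel
  -- both pairings are real parts of coefficient pairings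
  have hw : ⟪w, φ⟫_ℝ = (inner ℂ (mFourierCoeff (FunctionSpaces.EuclideanSpace.complexify ∘
      (w : UnitAddTorus d → EuclideanSpace ℝ d)) k) z).re :=
    inner_toLp_realTrigPoly_singleton w k (fun _ => z)
  have hv : ⟪v, φ⟫_ℝ = (inner ℂ (mFourierCoeff (FunctionSpaces.EuclideanSpace.complexify ∘
      (v : UnitAddTorus d → EuclideanSpace ℝ d)) k) z).re :=
    inner_toLp_realTrigPoly_singleton v k (fun _ => z)
  rw [← hw, ← hv]
  exact hrel

/-- **Testing the weak Stokes relation against a transversal mode.** If `w = -Δ v` weakly,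
`k ≠ 0` and `k · z = 0`, then `⟪ŵ(k), z⟫_ℂ = 4π²|k|² ⟪v̂(k), z⟫_ℂ` (real and imaginary parts from
`Torus.IsStokesImage.re_inner_mFourierCoeff` at `z` and at `i z`; Constantin–Foias 1988, Ch. 4,
(4.37)). [cite: ConstantinFoias1988, Ch. 4 (4.37)] -/
theorem IsStokesImage.inner_mFourierCoeff
    {v w : Lp (EuclideanSpace ℝ d) 2 (volume : Measure (UnitAddTorus d))}
    (h : IsStokesImage v w) {k : d → ℤ} (hk : k ≠ 0) {z : EuclideanSpace ℂ d}
    (hz : ∑ j, (k j : ℂ) * z j = 0) :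
    inner ℂ (mFourierCoeff (FunctionSpaces.EuclideanSpace.complexify ∘
        (w : UnitAddTorus d → EuclideanSpace ℝ d)) k) z =
      (stokesEigenvalue k : ℂ) * inner ℂ (mFourierCoeff (FunctionSpaces.EuclideanSpace.complexify ∘
        (v : UnitAddTorus d → EuclideanSpace ℝ d)) k) z := by
  -- `i z` is transversal as well
  have hIz : ∑ j, (k j : ℂ) * (Complex.I • z) j = 0 := by
    have h' : ∑ j, (k j : ℂ) * (Complex.I • z) j = Complex.I * ∑ j, (k j : ℂ) * z j := by
      rw [Finset.mul_sum]
      refine Finset.sum_congr rfl fun j _ => ?_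
      rw [PiLp.smul_apply, smul_eq_mul]
      ring
    rw [h', hz, mul_zero]
  have h1 := h.re_inner_mFourierCoeff hk hz
  have h2 := h.re_inner_mFourierCoeff hk hIz
  simp only [inner_smul_right, Complex.mul_re, Complex.I_re, Complex.I_im, zero_mul, one_mul,
    zero_sub, mul_neg, neg_inj] at h2
  apply Complex.ext
  · rw [Complex.re_ofReal_mul]
    exact h1
  · rw [Complex.im_ofReal_mul]
    exact h2

/-- **The Stokes graph on the Fourier side** (Constantin–Foias 1988, Ch. 4, (4.37):
`(Au)_k = 4π²|k|² u_k`): if `v, w ∈ H` and `w = -Δ v` weakly, then `ŵ(k) = 4π²|k|² v̂(k)` for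
every `k ∈ ℤ^d`. For `k = 0` both sides vanish (`H` is mean zero); for `k ≠ 0` the difference
`ŵ(k) − 4π²|k|² v̂(k)` is transversal (`H` is weakly divergence free) and orthogonal to every
transversal vector (`Torus.IsStokesImage.inner_mFourierCoeff`), hence zero.
[cite: ConstantinFoias1988, Ch. 4 (4.37)] -/
theorem IsStokesImage.mFourierCoeff_eq
    {v w : Lp (EuclideanSpace ℝ d) 2 (volume : Measure (UnitAddTorus d))}
    (hv : v ∈ FunctionSpaces.Torus.energySpace d) (hw : w ∈ FunctionSpaces.Torus.energySpace d)
    (h : IsStokesImage v w) (k : d → ℤ) :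
    mFourierCoeff (FunctionSpaces.EuclideanSpace.complexify ∘
        (w : UnitAddTorus d → EuclideanSpace ℝ d)) k =
      (stokesEigenvalue k : ℂ) • mFourierCoeff (FunctionSpaces.EuclideanSpace.complexify ∘
        (v : UnitAddTorus d → EuclideanSpace ℝ d)) k := by
  by_cases hk : k = 0
  · subst hk
    simp only [mFourierCoeff_complexify_coe_zero_of_mem hv,
      mFourierCoeff_complexify_coe_zero_of_mem hw, smul_zero]
  -- transversality of the coefficients of `v` and `w`
  have htv : ∑ j, (k j : ℂ) * (mFourierCoeff (FunctionSpaces.EuclideanSpace.complexify ∘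
      (v : UnitAddTorus d → EuclideanSpace ℝ d)) k) j = 0 :=
    (isWeaklyDivFree_of_mem_energySpace hv).sum_mul_mFourierCoeff_eq_zero (Lp.memLp v) k
  have htw : ∑ j, (k j : ℂ) * (mFourierCoeff (FunctionSpaces.EuclideanSpace.complexify ∘
      (w : UnitAddTorus d → EuclideanSpace ℝ d)) k) j = 0 :=
    (isWeaklyDivFree_of_mem_energySpace hw).sum_mul_mFourierCoeff_eq_zero (Lp.memLp w) k
  set a := mFourierCoeff (FunctionSpaces.EuclideanSpace.complexify ∘
    (w : UnitAddTorus d → EuclideanSpace ℝ d)) k with ha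
  set b := mFourierCoeff (FunctionSpaces.EuclideanSpace.complexify ∘
    (v : UnitAddTorus d → EuclideanSpace ℝ d)) k with hb
  -- the difference is transversal ...
  set u : EuclideanSpace ℂ d := a - (stokesEigenvalue k : ℂ) • b with hu
  have htu : ∑ j, (k j : ℂ) * u j = 0 := by
    have h' : ∑ j, (k j : ℂ) * u j =
        ∑ j, (k j : ℂ) * a j - (stokesEigenvalue k : ℂ) * ∑ j, (k j : ℂ) * b j := by
      rw [Finset.mul_sum, ← Finset.sum_sub_distrib]
      refine Finset.sum_congr rfl fun j _ => ?_
      rw [hu, PiLp.sub_apply, PiLp.smul_apply, smul_eq_mul]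
      ring
    rw [h', htv, htw, mul_zero, sub_zero]
  -- ... and orthogonal to every transversal vector, hence to itself
  have horth : inner ℂ a u = (stokesEigenvalue k : ℂ) * inner ℂ b u :=
    h.inner_mFourierCoeff hk htu
  have hself : inner ℂ u u = 0 := by
    rw [hu, inner_sub_left, inner_smul_left, Complex.conj_ofReal, ← hu, horth, sub_self]
  have hu0 : u = 0 := inner_self_eq_zero.mp hself
  rw [hu] at hu0
  exact sub_eq_zero.mp hu0

/-! ## Symmetry and positivity of the graph relation -/

omit [DecidableEq d] in
/-- Parseval for the `L²(T^d; ℝ^d)` inner product of two classes: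
`⟪v, w⟫_{L²} = ∑_k Re ⟪v̂(k), ŵ(k)⟫_ℂ` (Grafakos 2014, Prop. 3.2.7 (3), polarised;
`Torus.hasSum_re_inner_mFourierCoeff_complexify` with `L2.inner_def`). [cite: Grafakos2014, Prop. 3.2.7 (3)] -/
theorem hasSum_re_inner_mFourierCoeff_inner
    (v w : Lp (EuclideanSpace ℝ d) 2 (volume : Measure (UnitAddTorus d))) :
    HasSum (fun k : d → ℤ =>
      (inner ℂ (mFourierCoeff (FunctionSpaces.EuclideanSpace.complexify ∘
          (v : UnitAddTorus d → EuclideanSpace ℝ d)) k)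
        (mFourierCoeff (FunctionSpaces.EuclideanSpace.complexify ∘
          (w : UnitAddTorus d → EuclideanSpace ℝ d)) k)).re) ⟪v, w⟫_ℝ := by
  rw [MeasureTheory.L2.inner_def]
  exact FunctionSpaces.Torus.hasSum_re_inner_mFourierCoeff_complexify (Lp.memLp v) (Lp.memLp w)

/-- **Symmetry of the Stokes graph** (Constantin–Foias 1988, Ch. 4, Prop. 4.2 / (4.4):
`(Au, v) = ((u, v)) = (u, Av)`): if `(v, w)` and `(v', w')` are two pairs in `H × H` with
`w = -Δ v`, `w' = -Δ v'` weakly, then `⟪w, v'⟫ = ⟪v, w'⟫` — both equal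
`∑_k 4π²|k|² Re ⟪v̂(k), v̂'(k)⟫_ℂ` by Parseval and `Torus.IsStokesImage.mFourierCoeff_eq`.
[cite: ConstantinFoias1988, Ch. 4 Prop. 4.2] -/
theorem IsStokesImage.inner_symm
    {v w v' w' : Lp (EuclideanSpace ℝ d) 2 (volume : Measure (UnitAddTorus d))}
    (hv : v ∈ FunctionSpaces.Torus.energySpace d) (hw : w ∈ FunctionSpaces.Torus.energySpace d)
    (hv' : v' ∈ FunctionSpaces.Torus.energySpace d)
    (hw' : w' ∈ FunctionSpaces.Torus.energySpace d) (h : IsStokesImage v w)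
    (h' : IsStokesImage v' w') : ⟪w, v'⟫_ℝ = ⟪v, w'⟫_ℝ := by
  have h1 := hasSum_re_inner_mFourierCoeff_inner w v'
  have h2 := hasSum_re_inner_mFourierCoeff_inner v w'
  have he : (fun k : d → ℤ =>
      (inner ℂ (mFourierCoeff (FunctionSpaces.EuclideanSpace.complexify ∘
          (w : UnitAddTorus d → EuclideanSpace ℝ d)) k)
        (mFourierCoeff (FunctionSpaces.EuclideanSpace.complexify ∘
          (v' : UnitAddTorus d → EuclideanSpace ℝ d)) k)).re) =
      fun k : d → ℤ =>
      (inner ℂ (mFourierCoeff (FunctionSpaces.EuclideanSpace.complexify ∘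
          (v : UnitAddTorus d → EuclideanSpace ℝ d)) k)
        (mFourierCoeff (FunctionSpaces.EuclideanSpace.complexify ∘
          (w' : UnitAddTorus d → EuclideanSpace ℝ d)) k)).re := by
    funext k
    rw [h.mFourierCoeff_eq hv hw k, h'.mFourierCoeff_eq hv' hw' k, inner_smul_left,
      inner_smul_right, Complex.conj_ofReal]
  rw [he] at h1
  exact h1.unique h2

/-- **Positivity of the Stokes graph** (Constantin–Foias 1988, Ch. 4, (4.4) with (4.37):
`(Au, u) = ((u, u)) = ∑_k 4π²|k|² |u_k|² ≥ 0`): if `v, w ∈ H` and `w = -Δ v` weakly, then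
`0 ≤ ⟪v, w⟫`. [cite: ConstantinFoias1988, Ch. 4 (4.4)] -/
theorem IsStokesImage.inner_nonneg
    {v w : Lp (EuclideanSpace ℝ d) 2 (volume : Measure (UnitAddTorus d))}
    (hv : v ∈ FunctionSpaces.Torus.energySpace d) (hw : w ∈ FunctionSpaces.Torus.energySpace d)
    (h : IsStokesImage v w) : 0 ≤ ⟪v, w⟫_ℝ := by
  refine (hasSum_re_inner_mFourierCoeff_inner v w).nonneg fun k => ?_
  show 0 ≤ (inner ℂ (mFourierCoeff (FunctionSpaces.EuclideanSpace.complexify ∘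
      (v : UnitAddTorus d → EuclideanSpace ℝ d)) k)
    (mFourierCoeff (FunctionSpaces.EuclideanSpace.complexify ∘
      (w : UnitAddTorus d → EuclideanSpace ℝ d)) k)).re
  rw [h.mFourierCoeff_eq hv hw k, inner_smul_right, Complex.re_ofReal_mul]
  refine mul_nonneg (stokesEigenvalue_nonneg k) ?_
  rw [inner_self_eq_norm_sq_to_K]
  norm_cast
  exact sq_nonneg _

/-! ## The discharges -/

/-- **Discharge** of the named fact `Torus.isPositive_stokesOperator`: the `L²(T^d; ℝ^d)`-valued
Stokes operator `A = Torus.stokesOperator d` is positive — symmetric, `⟪A x, y⟫ = ⟪x, A y⟫`, and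
`0 ≤ ⟪x, A x⟫` on `D(A)` (H21 `LinearPMap.IsPositive`; Constantin–Foias 1988, Ch. 4, Prop. 4.2,
(4.4), (4.37)). Its graph is `Torus.stokesGraph d` (`Submodule.mem_graph_toLinearPMap`), to whose
pairs `Torus.IsStokesImage.inner_symm` / `Torus.IsStokesImage.inner_nonneg` apply.
[cite: ConstantinFoias1988, Ch. 4 Prop. 4.2] -/
theorem isPositive_stokesOperator_holds : isPositive_stokesOperator (d := d) := by
  unfold isPositive_stokesOperator LinearPMap.IsPositive
  have hgraph : ∀ x : (stokesOperator d).domain,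
      ((x : Lp (EuclideanSpace ℝ d) 2 (volume : Measure (UnitAddTorus d))), stokesOperator d x) ∈
        stokesGraph d := fun x =>
    Submodule.mem_graph_toLinearPMap stokesGraph_fst_eq_zero_imp x
  refine ⟨fun x y => ?_, fun x => ?_⟩
  · obtain ⟨hxH, hAxH, hx⟩ := hgraph x
    obtain ⟨hyH, hAyH, hy⟩ := hgraph y
    exact hx.inner_symm hxH hAxH hyH hAyH hy
  · obtain ⟨hxH, hAxH, hx⟩ := hgraph x
    rw [RCLike.re_to_real]
    exact hx.inner_nonneg hxH hAxH

/-- **Discharge** of the named fact `Torus.isPositive_stokesOperatorH`: the Stokes operator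
`A = Torus.stokesOperatorH d` *in the Hilbert space* `H = Torus.energySpace d` is positive —
symmetric and `0 ≤ ⟪x, A x⟫` on `D(A)` (H21 `LinearPMap.IsPositive`; Constantin–Foias 1988,
Ch. 4, Prop. 4.2, (4.4): `(Au, v) = ((u, v))`, and the periodic description (4.35)–(4.37)). Its
graph is `Torus.stokesGraphH d`, i.e. the pairs of elements of `H` in the weak Stokes relation,
and the inner product of `H` is that of `L²` (`Submodule.coe_inner`), so
`Torus.IsStokesImage.inner_symm` / `Torus.IsStokesImage.inner_nonneg` apply.
[cite: ConstantinFoias1988, Ch. 4 Prop. 4.2] -/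
theorem isPositive_stokesOperatorH_holds : isPositive_stokesOperatorH (d := d) := by
  unfold isPositive_stokesOperatorH LinearPMap.IsPositive
  have hgraph : ∀ x : (stokesOperatorH d).domain,
      ((x : FunctionSpaces.Torus.energySpace d), stokesOperatorH d x) ∈ stokesGraphH d := fun x =>
    Submodule.mem_graph_toLinearPMap stokesGraphH_fst_eq_zero_imp x
  refine ⟨fun x y => ?_, fun x => ?_⟩
  · have hx : IsStokesImage
        ((x : FunctionSpaces.Torus.energySpace d) :
          Lp (EuclideanSpace ℝ d) 2 (volume : Measure (UnitAddTorus d)))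
        ((stokesOperatorH d x : FunctionSpaces.Torus.energySpace d) :
          Lp (EuclideanSpace ℝ d) 2 (volume : Measure (UnitAddTorus d))) := hgraph x
    have hy : IsStokesImage
        ((y : FunctionSpaces.Torus.energySpace d) :
          Lp (EuclideanSpace ℝ d) 2 (volume : Measure (UnitAddTorus d)))
        ((stokesOperatorH d y : FunctionSpaces.Torus.energySpace d) :
          Lp (EuclideanSpace ℝ d) 2 (volume : Measure (UnitAddTorus d))) := hgraph y
    rw [Submodule.coe_inner, Submodule.coe_inner]
    exact hx.inner_symm (x : FunctionSpaces.Torus.energySpace d).2 (stokesOperatorH d x).2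
      (y : FunctionSpaces.Torus.energySpace d).2 (stokesOperatorH d y).2 hy
  · have hx : IsStokesImage
        ((x : FunctionSpaces.Torus.energySpace d) :
          Lp (EuclideanSpace ℝ d) 2 (volume : Measure (UnitAddTorus d)))
        ((stokesOperatorH d x : FunctionSpaces.Torus.energySpace d) :
          Lp (EuclideanSpace ℝ d) 2 (volume : Measure (UnitAddTorus d))) := hgraph x
    rw [RCLike.re_to_real, Submodule.coe_inner]
    exact hx.inner_nonneg (x : FunctionSpaces.Torus.energySpace d).2 (stokesOperatorH d x).2

end Torus

end Literature.Analysis.FluidPDE
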